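import Literature.Algebra.EuclideanLattices.KhotGapInstancesParam
import Literature.Algebra.EuclideanLattices.LatticeComplexity
import Literature.Computability.MetaComplexity.PromiseRandReductionsCounting
import Literature.Computability.Complexity.ResidueSampling
import HarnessLib

/-!
# Khot 2005: the specification of the machine — `gapSetCover 40 → GapSVP_{γ₀}` is a randomised reduction as soon as one `FP` function computes Khot's instances

Topic `Algebra/EuclideanLattices`, namespace `Literature.Algebra.EuclideanLattices.Khot`. The last
brick ABOVE the machine level of the decomposition of
`Literature.Algebra.EuclideanLattices.gapSVP_const_isNPHardRandomized` (pqc.S17) through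
`Khot2005_SAT_randReducible_gapSVP`: by `gapSVP_const_isNPHardRandomized_of_gapSetCover_forty`
(`KhotNPHardness.lean`) the target is reduced to `AroraEtAl1997_prop6` (PCP) and, for every `γ₀ ≥ 1`,
`PromiseRandReducible (gapSetCover 40) (gapSVPPromise fun _ => γ₀)`. This file PROVES the latter from
ONE hypothesis about ONE string function `F` — polynomial time (`F ∈ FP`) plus a purely functional
specification on pair codes `⟨code I, r⟩` — doing once and for all the probability bookkeeping:

* the coins `r ∈ {0,1}^{q(|x|)}` are read at distinct positions `pos I` (any injective map) as
  `31K` blocks of `M` bits (the tuple of column indices, `N = 2^M` columns) and one block of `b_I`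
  bits per row of the intermediate lattice (numbers below `2^{b_I}`, reduced modulo `q_I`; the
  modulus `q_I = 100·#A·D` of `KhotParameters.lean` is not a power of two), `blockEquiv`;
* on YES/NO instances with `1 ≤ K ≤ σ` and `u ≥ 1`, `F ⟨code I, r⟩` is the code of
  `khotInstance …` (the instance of `KhotAssembly.lean`) for ANY admissible auxiliary data chosen
  by the machine: a `{0,1}`-matrix `P_I` with `40K`-wise independent columns, equivalences
  `eR_I, eC_I` to `Fin N_f` (`khot_gap_instances_of`, `KhotGapInstancesParam.lean`), `b_I` with
  `2·rows·q_I ≤ 2^{b_I}`;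
* instances with `K = 0` or `K > σ` go to the fixed NO instance `fixedNo γ₀`, instances with
  `1 ≤ K ≤ σ` and an empty universe to the fixed YES instance `fixedYes` (`mem_noSet_of_K_eq_zero`,
  `not_mem_noSet_of_univSize_eq_zero`; `K > σ` is never YES); non-codewords are off the promise.

Then (`promiseRandReducible_gapSetCover_gapSVP_of_spec`) the success probability is `≥ 24/25` on
YES and `≥ 49/50` on NO instances: `khot_gap_instances_of` (`2/100`, `1/100` over tuples × `(ℤ/q)^{rows}`),
the residue-sampling transfer `ResidueSampling.mul_card_filter_prod_redVec_le` (at most doubling),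
and the marginal lemma `le_uniformProb_of_marginal` (`PromiseRandReductionsCounting.lean`). What is
NOT here: the function `F` itself and its running time (Khot 2005, Thm. 5.1 (1), §7.3; Thm. 4.1 "it
can be constructed efficiently") — the machine level proper.

## References

* S. Khot, *Hardness of approximating the shortest vector problem in lattices*, J. ACM 52 (2005)
  789–808, Thm. 1.1, Thm. 3.1, Thm. 5.1, §5.2.1–5.2.2, §7.3.
* S. Arora, B. Barak, *Computational Complexity: A Modern Approach*, CUP 2009, Def. 7.3, §7.6.
-/

noncomputable section

namespace Literature.Algebra.EuclideanLattices.Khot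

open Matrix Finset Params Computability
open Literature.Computability.Complexity Literature.Computability.MetaComplexity
open Literature.Computability.Complexity.ResidueSampling

/-! ### Fixed YES and NO instances of `GapSVP_{γ₀}` -/

/-- A fixed YES instance of `GapSVP_γ` for every `γ`: the lattice `ℤ` (basis `(1)`) with
threshold `1`. [cite: MicciancioGoldwasser2002, Ch. 1 §1.2] -/
def fixedYes : GapSVPInstance :=
  (columnInstance (1 : Matrix (Fin 1) (Fin 1) ℤ), 1)

/-- `fixedYes ∈ GapSVP.yes γ` (`λ₁(ℤ) = 1 ≤ 1`). [cite: MicciancioGoldwasser2002, Ch. 1 §1.2] -/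
theorem fixedYes_mem (γ : ℕ → ℝ) : fixedYes ∈ GapSVP.yes γ := by
  refine columnInstance_mem_gapSVP_yes γ (fun u hu => by simpa using hu) one_pos
    (u := fun _ => 1) (by rw [Matrix.one_mulVec]; exact Function.ne_iff.2 ⟨0, one_ne_zero⟩) ?_
  simp [intSqNorm]

/-- A fixed NO instance of `GapSVP_{γ₀}` for a constant `γ₀ ≥ 0`: the lattice `ℤ` with threshold
`1 / (2(⌈γ₀⌉₊ + 1))`, so that `γ₀ · d < 1 = λ₁(ℤ)`. [cite: MicciancioGoldwasser2002, Ch. 1 §1.2] -/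
def fixedNo (γ₀ : ℝ) : GapSVPInstance :=
  (columnInstance (1 : Matrix (Fin 1) (Fin 1) ℤ), 1 / (2 * ((⌈γ₀⌉₊ : ℚ) + 1)))

/-- `fixedNo γ₀ ∈ GapSVP.no (fun _ => γ₀)` for `γ₀ ≥ 0`. [cite: MicciancioGoldwasser2002, Ch. 1 §1.2] -/
theorem fixedNo_mem {γ₀ : ℝ} (hγ₀ : 0 ≤ γ₀) : fixedNo γ₀ ∈ GapSVP.no fun _ => γ₀ := by
  have hc : (0 : ℚ) < 2 * ((⌈γ₀⌉₊ : ℚ) + 1) := by positivity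
  refine columnInstance_mem_gapSVP_no (γ := fun _ => γ₀) one_pos (fun u hu => by simpa using hu)
    (one_div_pos.2 hc) (b := 1) (fun u hu => by simpa using one_le_intSqNorm hu) hγ₀ ?_
  have hγ : γ₀ ≤ (⌈γ₀⌉₊ : ℝ) := Nat.le_ceil γ₀
  have hcast : ((1 / (2 * ((⌈γ₀⌉₊ : ℚ) + 1)) : ℚ) : ℝ) = 1 / (2 * ((⌈γ₀⌉₊ : ℝ) + 1)) := by
    push_cast; ring
  have hpos : (0 : ℝ) < 2 * ((⌈γ₀⌉₊ : ℝ) + 1) := by positivity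
  have h1 : γ₀ * (1 / (2 * ((⌈γ₀⌉₊ : ℝ) + 1))) ≤ 1 / 2 := by
    rw [mul_one_div, div_le_div_iff₀ hpos two_pos]
    nlinarith
  have h0 : 0 ≤ γ₀ * (1 / (2 * ((⌈γ₀⌉₊ : ℝ) + 1))) := by positivity
  show (γ₀ * ((1 / (2 * ((⌈γ₀⌉₊ : ℚ) + 1)) : ℚ) : ℝ)) ^ 2 < ((1 : ℤ) : ℝ)
  rw [hcast, Int.cast_one]
  nlinarith

/-! ### Reading the coins: blocks of bits as numbers -/

/-- `a` bits as a number below `2^a` (Mathlib `finFunctionFinEquiv`, least significant bit at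
index `0`). [folklore] -/
def bitsEquiv (a : ℕ) : (Fin a → Bool) ≃ Fin (2 ^ a) :=
  (Equiv.arrowCongr (Equiv.refl (Fin a)) finTwoEquiv.symm).trans finFunctionFinEquiv

/-- **The block decoder**: bits indexed by `(Fin t × Fin a) ⊕ (R × Fin b)` as a tuple of `t` numbers
below `2^a` and an `R`-vector of numbers below `2^b`. [folklore] -/
def blockEquiv (t a : ℕ) (R : Type) (b : ℕ) :
    (((Fin t × Fin a) ⊕ (R × Fin b)) → Bool) ≃ ((Fin t → Fin (2 ^ a)) × (R → Fin (2 ^ b))) :=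
  (Equiv.sumArrowEquivProdArrow _ _ _).trans
    (Equiv.prodCongr
      ((Equiv.curry _ _ _).trans (Equiv.piCongrRight fun _ => bitsEquiv a))
      ((Equiv.curry _ _ _).trans (Equiv.piCongrRight fun _ => bitsEquiv b)))

/-! ### The specification theorem -/

section Spec

/-- The row index type of the intermediate lattice of an instance. [cite: Khot2005, §5.1] -/
abbrev IRows (I : SetCoverInstance) (k : ℕ) : Type := RowsT I.univSize I.sets.length I.K k

/-- The column index type of the base basis of an instance. [cite: Khot2005, §5.2.2] -/
abbrev ICols (I : SetCoverInstance) (k : ℕ) : Type := ColsT I.univSize I.sets.length I.K k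

/-- The type of the BCH matrix of an instance. [cite: Khot2005, §4] -/
abbrev IBCH (I : SetCoverInstance) (k : ℕ) : Type :=
  Matrix (Fin (20 * I.K) × Fin (MM I.univSize I.sets.length I.K k + 1))
    (Fin (NN I.univSize I.sets.length I.K k)) ℤ

/-- The coin positions of an instance: `31K` blocks of `MM` bits and one block of `b` bits per
row. [cite: Khot2005, §5.2.2 and Lemma 4.3] -/
abbrev IBits (I : SetCoverInstance) (k b : ℕ) : Type :=
  (Fin (31 * I.K) × Fin (MM I.univSize I.sets.length I.K k)) ⊕ (IRows I k × Fin b)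

/-- **The instance Khot's machine must output** on the instance `I` (with `1 ≤ K ≤ σ`, `u ≥ 1`)
and the decoded coins `ω = (g, Y)`: `khotInstance` of `KhotAssembly.lean` for the explicit
parameters, the machine's BCH matrix `P`, equivalences `eR, eC`, the shift sampled from the
tuple `g`, and the row vector `Y mod q`. [cite: Khot2005, §5.2.2 and §7.3] -/
def specInstance (k : ℕ) (I : SetCoverInstance) (hu : 1 ≤ I.univSize) (P : IBCH I k) {Nf : ℕ}
    (eR : Out (IRows I k ⊕ Unit) (ICols I k) k ≃ Fin Nf)
    (eC : (Coef (ICols I k) k ⊕ {o // augPad (n := ICols I k)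
      (basePad (S := Fin I.sets.length) (H := Fin (20 * I.K) × Fin (MM I.univSize I.sets.length I.K k + 1))
        (Nn := Fin (NN I.univSize I.sets.length I.K k)) (⟨0, hu⟩ : Fin I.univSize)) k o}) ≃ Fin Nf)
    {b : ℕ} (ω : (Fin (31 * I.K) → Fin (2 ^ MM I.univSize I.sets.length I.K k)) × (IRows I k → Fin (2 ^ b))) :
    GapSVPInstance :=
  let u := I.univSize; let σ := I.sets.length; let K := I.K
  khotInstance (DD u σ K k : ℤ) (setSystem I) P (tupleShift P ω.1) (DD u σ K k : ℤ) (qq u σ K k)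
    (⟨0, hu⟩ : Fin u) ((ss u σ K k ^ k : ℕ) : ℤ) k (DD u σ K k : ℤ) (tauN u σ K k : ℚ) eR eC
    (redVec (q := qq u σ K k) ω.2)

/-- **Khot 2005, Thm. 1.1 at the level of one machine's specification.** Fix `γ₀ ≥ 1` and `k` with
`8γ₀² < (8/7)^k`. Suppose `F ∈ FP` and a coin polynomial `qc` satisfy, for the code `x = code I` of
every set cover instance: (i) if `K = 0` or `K > σ` then `F ⟨x, r⟩ = code (fixedNo γ₀)` for all
`r` of length `qc |x|`; (ii) if `1 ≤ K ≤ σ` and `u = 0` then `F ⟨x, r⟩ = code fixedYes`; (iii) if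
`1 ≤ K ≤ σ` and `u ≥ 1` then, for the machine's admissible data (`P`, `eR`, `eC`, `b` with
`2·rows·q ≤ 2^b`, injective coin positions `pos`), `F ⟨x, ofFn f⟩ = code (specInstance …
(blockEquiv … (f ∘ pos)))` for every `f : Fin (qc |x|) → Bool`. Then
`PromiseRandReducible (gapSetCover 40) (gapSVPPromise fun _ => γ₀)` — success probability `≥ 24/25`
on YES instances and `≥ 49/50` on NO instances. [cite: Khot2005, Thm. 1.1 and §7.3] -/
theorem promiseRandReducible_gapSetCover_gapSVP_of_spec (γ₀ : ℝ) (hγ₀ : 1 ≤ γ₀) (k : ℕ)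
    (hk : 8 * γ₀ ^ 2 < (8 / 7 : ℝ) ^ k) {F : List Bool → List Bool} (hF : F ∈ FP) (qc : Polynomial ℕ)
    -- the machine's auxiliary data on instances with `1 ≤ K ≤ σ`, `u ≥ 1`
    (P : ∀ I : SetCoverInstance, IBCH I k)
    (Nf : SetCoverInstance → ℕ)
    (eR : ∀ I : SetCoverInstance, Out (IRows I k ⊕ Unit) (ICols I k) k ≃ Fin (Nf I))
    (eC : ∀ (I : SetCoverInstance) (hu : 1 ≤ I.univSize), (Coef (ICols I k) k ⊕ {o // augPad (n := ICols I k)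
      (basePad (S := Fin I.sets.length) (H := Fin (20 * I.K) × Fin (MM I.univSize I.sets.length I.K k + 1))
        (Nn := Fin (NN I.univSize I.sets.length I.K k)) (⟨0, hu⟩ : Fin I.univSize)) k o}) ≃ Fin (Nf I))
    (b : SetCoverInstance → ℕ)
    (pos : ∀ I : SetCoverInstance, IBits I k (b I) → Fin (qc.eval (SetCoverInstance.encoding.encode I).length))
    (hdata : ∀ I : SetCoverInstance, 1 ≤ I.K → I.K ≤ I.sets.length → 1 ≤ I.univSize →
      (∀ r i, P I r i = 0 ∨ P I r i = 1) ∧ DWise (P I) (40 * I.K) ∧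
      2 * Fintype.card (IRows I k) * qq I.univSize I.sets.length I.K k ≤ 2 ^ b I ∧
      Function.Injective (pos I))
    -- the functional specification
    (hzero : ∀ I : SetCoverInstance, I.K = 0 ∨ I.sets.length < I.K → ∀ r : List Bool,
      r.length = qc.eval (SetCoverInstance.encoding.encode I).length →
        F (boolPair (SetCoverInstance.encoding.encode I) r) = GapSVPInstance.encode (fixedNo γ₀))
    (hempty : ∀ I : SetCoverInstance, 1 ≤ I.K → I.K ≤ I.sets.length → I.univSize = 0 → ∀ r : List Bool,
      r.length = qc.eval (SetCoverInstance.encoding.encode I).length →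
        F (boolPair (SetCoverInstance.encoding.encode I) r) = GapSVPInstance.encode fixedYes)
    (hmain : ∀ (I : SetCoverInstance) (hK : 1 ≤ I.K) (hKσ : I.K ≤ I.sets.length) (hu : 1 ≤ I.univSize)
      (f : Fin (qc.eval (SetCoverInstance.encoding.encode I).length) → Bool),
        F (boolPair (SetCoverInstance.encoding.encode I) (List.ofFn f)) =
          GapSVPInstance.encode (specInstance k I hu (P I) (eR I) (eC I hu)
            (blockEquiv (31 * I.K) (MM I.univSize I.sets.length I.K k) (IRows I k) (b I) (f ∘ pos I)))) :
    PromiseRandReducible (gapSetCover 40) (gapSVPPromise fun _ => γ₀) := by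
  classical
  -- probability `1` when every coin string of the right length is good
  have hall : ∀ (E : Set (List Bool)) (m : ℕ),
      (∀ r : List Bool, r.length = m → r ∈ E) → (2 / 3 : ℝ) ≤ uniformProb m E := by
    intro E m h
    rw [uniformProb_eq_cnt_div, cnt_eq_two_pow_of_forall h]
    push_cast
    rw [div_self (by positivity)]
    norm_num
  -- the transfer from a `50 · #bad ≤ |Ω|` bound over tuples × `(ℤ/q)^rows` to the coins
  have transfer : ∀ (I : SetCoverInstance) (hu : 1 ≤ I.univSize)
      (hb : 2 * Fintype.card (IRows I k) * qq I.univSize I.sets.length I.K k ≤ 2 ^ b I)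
      (hpos : Function.Injective (pos I)) (S : Set GapSVPInstance) (E : Set (List Bool)),
      50 * #((univ : Finset ((Fin (31 * I.K) → Fin (NN I.univSize I.sets.length I.K k)) ×
          (IRows I k → ZMod (qq I.univSize I.sets.length I.K k)))).filter fun ω =>
            khotInstance (DD I.univSize I.sets.length I.K k : ℤ) (setSystem I) (P I) (tupleShift (P I) ω.1)
              (DD I.univSize I.sets.length I.K k : ℤ) (qq I.univSize I.sets.length I.K k) (⟨0, hu⟩ : Fin I.univSize)
              ((ss I.univSize I.sets.length I.K k ^ k : ℕ) : ℤ) k (DD I.univSize I.sets.length I.K k : ℤ)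
              (tauN I.univSize I.sets.length I.K k : ℚ) (eR I) (eC I hu) ω.2 ∉ S) ≤
        Fintype.card (Fin (31 * I.K) → Fin (NN I.univSize I.sets.length I.K k)) *
          qq I.univSize I.sets.length I.K k ^ Fintype.card (IRows I k) →
      (∀ f : Fin (qc.eval (SetCoverInstance.encoding.encode I).length) → Bool,
        specInstance k I hu (P I) (eR I) (eC I hu)
          (blockEquiv (31 * I.K) (MM I.univSize I.sets.length I.K k) (IRows I k) (b I) (f ∘ pos I)) ∈ S →
        List.ofFn f ∈ E) →
      (2 / 3 : ℝ) ≤ uniformProb (qc.eval (SetCoverInstance.encoding.encode I).length) E := by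
    intro I hu hb hpos S E h50 hE
    haveI : NeZero (qq I.univSize I.sets.length I.K k) := ⟨by unfold qq; omega⟩
    have htr : 50 * #{o : (Fin (31 * I.K) → Fin (NN I.univSize I.sets.length I.K k)) × (IRows I k → Fin (2 ^ b I)) |
        specInstance k I hu (P I) (eR I) (eC I hu) o ∉ S} ≤
        2 * (Fintype.card (Fin (31 * I.K) → Fin (NN I.univSize I.sets.length I.K k)) *
          (2 ^ b I) ^ Fintype.card (IRows I k)) :=
      mul_card_filter_prod_redVec_le (M := 2 ^ b I) (q := qq I.univSize I.sets.length I.K k)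
        (fun ω : (Fin (31 * I.K) → Fin (NN I.univSize I.sets.length I.K k)) ×
            (IRows I k → ZMod (qq I.univSize I.sets.length I.K k)) =>
          khotInstance (DD I.univSize I.sets.length I.K k : ℤ) (setSystem I) (P I) (tupleShift (P I) ω.1)
            (DD I.univSize I.sets.length I.K k : ℤ) (qq I.univSize I.sets.length I.K k) (⟨0, hu⟩ : Fin I.univSize)
            ((ss I.univSize I.sets.length I.K k ^ k : ℕ) : ℤ) k (DD I.univSize I.sets.length I.K k : ℤ)
            (tauN I.univSize I.sets.length I.K k : ℚ) (eR I) (eC I hu) ω.2 ∉ S) h50 hb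
    have hΩ : Fintype.card (Fin (31 * I.K) → Fin (NN I.univSize I.sets.length I.K k)) =
        (2 ^ MM I.univSize I.sets.length I.K k) ^ (31 * I.K) := by
      rw [Fintype.card_fun, Fintype.card_fin, Fintype.card_fin]; rfl
    rw [hΩ] at htr
    refine le_trans (by norm_num) (le_uniformProb_of_marginal (pos I) hpos
      (blockEquiv (31 * I.K) (MM I.univSize I.sets.length I.K k) (IRows I k) (b I))
      (fun o => specInstance k I hu (P I) (eR I) (eC I hu) o ∉ S) E
      (fun f hf => hE f (not_not.1 hf)) (by norm_num : (0 : ℕ) < 25) (a := 1) ?_)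
    have hΩ' : Fintype.card ((Fin (31 * I.K) → Fin (2 ^ MM I.univSize I.sets.length I.K k)) ×
        (IRows I k → Fin (2 ^ b I))) =
        (2 ^ MM I.univSize I.sets.length I.K k) ^ (31 * I.K) * (2 ^ b I) ^ Fintype.card (IRows I k) := by
      rw [Fintype.card_prod, Fintype.card_fun, Fintype.card_fun, Fintype.card_fin, Fintype.card_fin,
        Fintype.card_fin]
    rw [hΩ']
    have key : 50 * #{o : (Fin (31 * I.K) → Fin (2 ^ MM I.univSize I.sets.length I.K k)) ×
        (IRows I k → Fin (2 ^ b I)) | specInstance k I hu (P I) (eR I) (eC I hu) o ∉ S} ≤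
        2 * ((2 ^ MM I.univSize I.sets.length I.K k) ^ (31 * I.K) * (2 ^ b I) ^ Fintype.card (IRows I k)) := htr
    omega
  refine promiseRandReducible_of_uniformProb hF qc ?_ ?_
  · -- YES instances
    rintro _ ⟨I, hI, rfl⟩
    obtain ⟨hK, T₀, hT₀card, hT₀ex⟩ := exactCover_of_mem_yesSet hI
    have hKσ : I.K ≤ I.sets.length := by
      rw [← hT₀card]; exact (card_le_univ T₀).trans_eq (Fintype.card_fin _)
    rcases Nat.eq_zero_or_pos I.univSize with hu0 | hu
    · -- empty universe: the fixed YES instance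
      refine hall _ _ fun r hr => ?_
      show F (boolPair (SetCoverInstance.encoding.encode I) r) ∈ GapSVP.yesLang fun _ => γ₀
      rw [hempty I hK hKσ hu0 r hr, GapSVP.encode_mem_yesLang_iff]
      exact fixedYes_mem _
    · -- the main case
      obtain ⟨hP01, hDW, hb, hpos⟩ := hdata I hK hKσ hu
      have hgap := (khot_gap_instances_of γ₀ hγ₀ k hk I.univSize I.sets.length I.K hu hK (setSystem I) (P I)
        hP01 hDW (Nf I) (eR I) (eC I hu)).1 ⟨T₀, hT₀card, hT₀ex⟩
      refine transfer I hu hb hpos (GapSVP.yes fun _ => γ₀) _ ?_ fun f hf => ?_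
      · simp only [IRows, Fintype.card_pi, prod_const, card_univ, Fintype.card_fin] at hgap ⊢
        omega
      · show F (boolPair (SetCoverInstance.encoding.encode I) (List.ofFn f)) ∈ GapSVP.yesLang fun _ => γ₀
        rw [hmain I hK hKσ hu f, GapSVP.encode_mem_yesLang_iff]
        exact hf
  · -- NO instances
    rintro _ ⟨I, hI, rfl⟩
    by_cases hKσ' : I.K = 0 ∨ I.sets.length < I.K
    · -- degenerate sizes: the fixed NO instance
      refine hall _ _ fun r hr => ?_
      show F (boolPair (SetCoverInstance.encoding.encode I) r) ∈ GapSVP.noLang fun _ => γ₀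
      rw [hzero I hKσ' r hr, GapSVP.encode_mem_noLang_iff]
      exact fixedNo_mem (by linarith)
    push Not at hKσ'
    obtain ⟨hK0, hKσ⟩ := hKσ'
    have hK : 1 ≤ I.K := Nat.pos_of_ne_zero hK0
    have hu : 1 ≤ I.univSize := by
      by_contra hu
      push Not at hu
      exact not_mem_noSet_of_univSize_eq_zero (Nat.lt_one_iff.1 hu) hK (by norm_num) hI
    obtain ⟨hP01, hDW, hb, hpos⟩ := hdata I hK hKσ hu
    have hgap := (khot_gap_instances_of γ₀ hγ₀ k hk I.univSize I.sets.length I.K hu hK (setSystem I) (P I)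
      hP01 hDW (Nf I) (eR I) (eC I hu)).2 (noCover_of_mem_noSet hI)
    refine transfer I hu hb hpos (GapSVP.no fun _ => γ₀) _ ?_ fun f hf => ?_
    · simp only [IRows, Fintype.card_pi, prod_const, card_univ, Fintype.card_fin] at hgap ⊢
      omega
    · show F (boolPair (SetCoverInstance.encoding.encode I) (List.ofFn f)) ∈ GapSVP.noLang fun _ => γ₀
      rw [hmain I hK hKσ hu f, GapSVP.encode_mem_noLang_iff]
      exact hf

end Spec

end Literature.Algebra.EuclideanLattices.Khot
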